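import Mathlib
import Summits.Ventures.PercRepro2.Defs
import Summits.Ventures.PercRepro2.Independence
import Summits.Ventures.PercRepro2.Graph
import Summits.Ventures.PercRepro2.Events

/-!
# Row 2′MM0, the series rule I: the series map, the reduced graph and their connections
(blind cell PercRepro2, night-1 g4; `proofs/NIGHT1-G4.md` §3)

The second rule of the MARKED-SKELETON reduction behind «(MM0⁻) on every forest» (the leaf rule is
`MM0Prune`). Let `x` be a vertex of degree two with edges `e₁ = s(a, x)` and `e₂ = s(x, c)`. The
reduced graph `seriesEnds` re-points `e₁` to `s(a, c)` and `e₂` to the loop `s(x, x)` (same edge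
type); the series map `seriesMap e₁ e₂ ω := ω[e₁ ↦ ω e₁ ∧ ω e₂]` sends a configuration of the
original graph to one of the reduced graph.

* `expect_seriesMap`: for an observable `f` that does not depend on `e₂`,
  `E_p[f ∘ seriesMap] = E_{p[e₁ ↦ p e₁ · p e₂]}[f]` (pin `e₁`, then `e₂`: the merged edge is open
  exactly in the open–open case);
* `conn_update_loop_iff'`: connections do not depend on the state of a loop edge;
* `conn_series_iff`: for vertices `m₁, m₂ ≠ x`, `m₁ ↔ m₂` in `(ends, ω)` iff in
  `(seriesEnds, seriesMap ω)` (closure lemma; the only way through `x` is `a – x – c`).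

`MM0Series` turns these into the identity `mm0minusForm p ends = mm0minusForm p′ (seriesEnds …)`.
-/

namespace Summit.Ventures.PercRepro2
namespace MM0Series

/-! ## The series map on configurations -/

section Map

variable {E : Type*} [DecidableEq E]

/-- The series map: the merged edge `e₁` is open iff both `e₁` and `e₂` were. -/
def seriesMap (e₁ e₂ : E) (ω : Config E) : Config E := Function.update ω e₁ (ω e₁ && ω e₂)

/-- The series map changes nothing off `e₁`. -/
lemma seriesMap_apply_of_ne {e₁ e₂ e : E} (h : e ≠ e₁) (ω : Config E) :
    seriesMap e₁ e₂ ω e = ω e := by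
  simp [seriesMap, Function.update_of_ne h]

/-- The series map at `e₁`: open iff both `e₁` and `e₂` are open. -/
lemma seriesMap_apply_self (e₁ e₂ : E) (ω : Config E) :
    seriesMap e₁ e₂ ω e₁ = (ω e₁ && ω e₂) := by
  simp [seriesMap]

/-- The series map after forcing `e₁` open: `e₁` takes the state of `e₂`. -/
lemma seriesMap_update_true {e₁ e₂ : E} (h12 : e₁ ≠ e₂) (ω : Config E) :
    seriesMap e₁ e₂ (Function.update ω e₁ true) = Function.update ω e₁ (ω e₂) := by
  simp [seriesMap, Function.update_of_ne h12.symm, Function.update_idem]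

/-- The series map after forcing `e₁` closed: `e₁` stays closed. -/
lemma seriesMap_update_false {e₁ e₂ : E} (h12 : e₁ ≠ e₂) (ω : Config E) :
    seriesMap e₁ e₂ (Function.update ω e₁ false) = Function.update ω e₁ false := by
  simp [seriesMap, Function.update_of_ne h12.symm, Function.update_idem]

end Map

/-! ## The expectation identity -/

section Expect

variable {E : Type*} [Fintype E] [DecidableEq E] {R : Type*} [CommRing R]

/-- **Series rule for expectations**: if `f` does not depend on `e₂`, then the expectation of
`f ∘ seriesMap` under `p` is the expectation of `f` under `p[e₁ ↦ p e₁ · p e₂]`. -/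
theorem expect_seriesMap (p : E → R) (f : Config E → R) {e₁ e₂ : E} (h12 : e₁ ≠ e₂)
    (hf : ∀ ω b, f (Function.update ω e₂ b) = f ω) :
    expect p (fun ω => f (seriesMap e₁ e₂ ω)) = expect (Function.update p e₁ (p e₁ * p e₂)) f := by
  -- the right-hand side pinned at `e₁`
  have hR : expect (Function.update p e₁ (p e₁ * p e₂)) f =
      p e₁ * p e₂ * expect (Function.update p e₁ 1) f
        + (1 - p e₁ * p e₂) * expect (Function.update p e₁ 0) f := by
    rw [expect_eq_pin (Function.update p e₁ (p e₁ * p e₂)) f e₁]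
    simp only [Function.update_self, Function.update_idem]
  -- the left-hand side pinned at `e₁`, then (open case) at `e₂`
  have hL0 : expect p (fun ω => f (seriesMap e₁ e₂ (Function.update ω e₁ false))) =
      expect (Function.update p e₁ 0) f := by
    rw [expect_update_zero]
    refine congrArg _ (funext fun ω => ?_)
    rw [seriesMap_update_false h12]
  have hg1 : ∀ ω, f (seriesMap e₁ e₂ (Function.update (Function.update ω e₂ true) e₁ true)) =
      f (Function.update ω e₁ true) := by
    intro ω
    rw [seriesMap_update_true h12]
    simp only [Function.update_self]
    rw [Function.update_comm h12.symm, hf]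
  have hg0 : ∀ ω, f (seriesMap e₁ e₂ (Function.update (Function.update ω e₂ false) e₁ true)) =
      f (Function.update ω e₁ false) := by
    intro ω
    rw [seriesMap_update_true h12]
    simp only [Function.update_self]
    rw [Function.update_comm h12.symm, hf]
  have hL1 : expect p (fun ω => f (seriesMap e₁ e₂ (Function.update ω e₁ true))) =
      p e₂ * expect (Function.update p e₁ 1) f + (1 - p e₂) * expect (Function.update p e₁ 0) f := by
    rw [expect_eq_pin p _ e₂, expect_update_one, expect_update_zero]
    simp only [hg1, hg0]
    rw [← expect_update_one, ← expect_update_zero]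
  rw [expect_eq_pin p _ e₁, expect_update_one, expect_update_zero, hL1, hL0, hR]
  ring

end Expect

/-! ## The reduced graph and its connections -/

section Graph

variable {V : Type*} {E : Type*} [DecidableEq E]

/-- The reduced graph: `e₁` re-pointed to `s(a, c)`, `e₂` to the loop `s(x, x)`. -/
def seriesEnds (ends : E → Sym2 V) (e₁ e₂ : E) (a c x : V) : E → Sym2 V :=
  Function.update (Function.update ends e₁ s(a, c)) e₂ s(x, x)

variable {ends : E → Sym2 V} {e₁ e₂ : E} {a c x : V}

/-- In the reduced graph `e₁` joins `a` and `c`. -/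
lemma seriesEnds_apply_e₁ (h12 : e₁ ≠ e₂) : seriesEnds ends e₁ e₂ a c x e₁ = s(a, c) := by
  simp [seriesEnds, Function.update_of_ne h12]

/-- In the reduced graph `e₂` is a loop at `x`. -/
lemma seriesEnds_apply_e₂ : seriesEnds ends e₁ e₂ a c x e₂ = s(x, x) := by
  simp [seriesEnds]

/-- The reduced graph agrees with the original off `e₁, e₂`. -/
lemma seriesEnds_apply_of_ne {e : E} (h1 : e ≠ e₁) (h2 : e ≠ e₂) :
    seriesEnds ends e₁ e₂ a c x e = ends e := by
  simp [seriesEnds, Function.update_of_ne h1, Function.update_of_ne h2]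

/-- A loop edge never contributes to a connection: the state of a loop edge is irrelevant. -/
lemma conn_update_loop_iff' {ends' : E → Sym2 V} {e : E} {y : V} (hl : ends' e = s(y, y))
    (ω : Config E) (b : Bool) {m₁ m₂ : V} :
    Conn ends' (Function.update ω e b) m₁ m₂ ↔ Conn ends' ω m₁ m₂ := by
  have key : ∀ (ω₁ ω₂ : Config E), (∀ e', e' ≠ e → ω₁ e' = ω₂ e') →
      Conn ends' ω₁ m₁ m₂ → Conn ends' ω₂ m₁ m₂ := by
    intro ω₁ ω₂ hω h
    let S : Set V := {z | Conn ends' ω₂ m₁ z}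
    have hS : ∀ z ∈ S, ∀ z', (openGraph ends' ω₁).Adj z z' → z' ∈ S := by
      intro z hz z' hzz'
      obtain ⟨hne, e', he', hends⟩ := openGraph_adj.1 hzz'
      by_cases hee : e' = e
      · subst hee
        rw [hl, Sym2.eq_iff] at hends
        rcases hends with ⟨h1, h2⟩ | ⟨h1, h2⟩
        · exact absurd (h1.symm.trans h2) hne
        · exact absurd (h2.symm.trans h1) hne
      · exact conn_trans hz (conn_of_openAdj ⟨e', by rw [← hω e' hee]; exact he', hends⟩)
    exact mem_of_conn_of_closed hS (conn_refl ends' ω₂ m₁) h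
  constructor
  · exact key _ _ fun e' he' => Function.update_of_ne he' _ _
  · exact key _ _ fun e' he' => (Function.update_of_ne he' _ _).symm

end Graph

/-! ## Connections through the series vertex -/

section Series

variable {V : Type*} {E : Type*} [DecidableEq E]
  {ends : E → Sym2 V} {e₁ e₂ : E} {a c x : V}

/-- A connection in the reduced graph lifts to the original graph (the merged edge open means
`a – x – c` open). -/
lemma conn_of_conn_series (h1 : ends e₁ = s(a, x)) (h2 : ends e₂ = s(x, c)) (h12 : e₁ ≠ e₂)
    {ω : Config E} {m₁ m₂ : V}
    (h : Conn (seriesEnds ends e₁ e₂ a c x) (seriesMap e₁ e₂ ω) m₁ m₂) : Conn ends ω m₁ m₂ := by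
  let S : Set V := {z | Conn ends ω m₁ z}
  have hS : ∀ z ∈ S, ∀ z',
      (openGraph (seriesEnds ends e₁ e₂ a c x) (seriesMap e₁ e₂ ω)).Adj z z' → z' ∈ S := by
    intro z hz z' hzz'
    obtain ⟨hne, e, he, hends⟩ := openGraph_adj.1 hzz'
    by_cases hee2 : e = e₂
    · rw [hee2, seriesEnds_apply_e₂, Sym2.eq_iff] at hends
      rcases hends with ⟨hh1, hh2⟩ | ⟨hh1, hh2⟩
      · exact absurd (hh1.symm.trans hh2) hne
      · exact absurd (hh2.symm.trans hh1) hne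
    by_cases hee1 : e = e₁
    · rw [hee1, seriesEnds_apply_e₁ h12] at hends
      rw [hee1, seriesMap_apply_self] at he
      have hopen : ω e₁ = true ∧ ω e₂ = true := by simpa using he
      have hac : Conn ends ω a c :=
        conn_trans (conn_of_openAdj ⟨e₁, hopen.1, h1⟩) (conn_of_openAdj ⟨e₂, hopen.2, h2⟩)
      rw [Sym2.eq_iff] at hends
      rcases hends with ⟨hz1, hz2⟩ | ⟨hz1, hz2⟩
      · subst hz1; subst hz2; exact conn_trans hz hac
      · subst hz1; subst hz2; exact conn_trans hz (conn_symm hac)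
    · rw [seriesEnds_apply_of_ne hee1 hee2] at hends
      rw [seriesMap_apply_of_ne hee1] at he
      exact conn_trans hz (conn_of_openAdj ⟨e, he, hends⟩)
  exact mem_of_conn_of_closed hS (conn_refl ends ω m₁) h

/-- A connection between two vertices other than `x` survives the series reduction. -/
lemma conn_series_of_conn (h1 : ends e₁ = s(a, x)) (h2 : ends e₂ = s(x, c))
    (hdeg : ∀ e, x ∈ ends e → e = e₁ ∨ e = e₂) (hax : a ≠ x) (hcx : c ≠ x) (h12 : e₁ ≠ e₂)
    {ω : Config E} {m₁ m₂ : V} (hm₁ : m₁ ≠ x) (hm₂ : m₂ ≠ x) (h : Conn ends ω m₁ m₂) :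
    Conn (seriesEnds ends e₁ e₂ a c x) (seriesMap e₁ e₂ ω) m₁ m₂ := by
  set ends' := seriesEnds ends e₁ e₂ a c x with hends'
  set ω' := seriesMap e₁ e₂ ω with hω'
  have hmerge : ω e₁ = true → ω e₂ = true → Conn ends' ω' a c := fun ha hc =>
    conn_of_openAdj ⟨e₁, by rw [hω', seriesMap_apply_self, ha, hc]; rfl,
      by rw [hends', seriesEnds_apply_e₁ h12]⟩
  let S : Set V := {z | (z ≠ x ∧ Conn ends' ω' m₁ z) ∨
    (z = x ∧ ((ω e₁ = true ∧ Conn ends' ω' m₁ a) ∨ (ω e₂ = true ∧ Conn ends' ω' m₁ c)))}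
  have hS : ∀ z ∈ S, ∀ z', (openGraph ends ω).Adj z z' → z' ∈ S := by
    intro z hz z' hzz'
    obtain ⟨hne, e, he, hends⟩ := openGraph_adj.1 hzz'
    by_cases hz'x : z' = x
    · -- the step enters `x`: the edge is `e₁` (from `a`) or `e₂` (from `c`)
      have hxe : x ∈ ends e := by rw [hends, ← hz'x]; exact Sym2.mem_mk_right z z'
      rcases hdeg e hxe with rfl | rfl
      · -- e = e₁, so z = a
        rw [h1, hz'x, Sym2.eq_iff] at hends
        have hza : z = a := by
          rcases hends with ⟨hh1, _⟩ | ⟨hh1, _⟩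
          · exact hh1.symm
          · exact absurd hh1 hax
        have hconn : Conn ends' ω' m₁ a := by
          rcases hz with ⟨_, hc⟩ | ⟨hzx, _⟩
          · exact hza ▸ hc
          · exact absurd (hza.symm.trans hzx) hax
        exact Or.inr ⟨hz'x, Or.inl ⟨he, hconn⟩⟩
      · -- e = e₂, so z = c
        rw [h2, hz'x, Sym2.eq_iff] at hends
        have hzc : z = c := by
          rcases hends with ⟨hh1, _⟩ | ⟨_, hh2⟩
          · exact absurd (hz'x.trans hh1).symm hne
          · exact hh2.symm
        have hconn : Conn ends' ω' m₁ c := by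
          rcases hz with ⟨_, hc⟩ | ⟨hzx, _⟩
          · exact hzc ▸ hc
          · exact absurd (hzc.symm.trans hzx) hcx
        exact Or.inr ⟨hz'x, Or.inr ⟨he, hconn⟩⟩
    by_cases hzx : z = x
    · -- the step leaves `x`: the edge is `e₁` (to `a`) or `e₂` (to `c`)
      have hxe : x ∈ ends e := by rw [hends, ← hzx]; exact Sym2.mem_mk_left z z'
      have hz2 : (ω e₁ = true ∧ Conn ends' ω' m₁ a) ∨ (ω e₂ = true ∧ Conn ends' ω' m₁ c) := by
        rcases hz with ⟨hzx', _⟩ | ⟨_, hh⟩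
        · exact absurd hzx hzx'
        · exact hh
      rcases hdeg e hxe with rfl | rfl
      · -- e = e₁, so z' = a
        rw [h1, hzx, Sym2.eq_iff] at hends
        have hz'a : z' = a := by
          rcases hends with ⟨hh1, _⟩ | ⟨hh1, _⟩
          · exact absurd hh1 hax
          · exact hh1.symm
        have hconn : Conn ends' ω' m₁ a := by
          rcases hz2 with ⟨_, hc⟩ | ⟨hc2, hc⟩
          · exact hc
          · exact conn_trans hc (conn_symm (hmerge he hc2))
        exact Or.inl ⟨hz'x, hz'a ▸ hconn⟩
      · -- e = e₂, so z' = c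
        rw [h2, hzx, Sym2.eq_iff] at hends
        have hz'c : z' = c := by
          rcases hends with ⟨_, hh2⟩ | ⟨hh1, _⟩
          · exact hh2.symm
          · exact absurd hh1.symm hz'x
        have hconn : Conn ends' ω' m₁ c := by
          rcases hz2 with ⟨hc1, hc⟩ | ⟨_, hc⟩
          · exact conn_trans hc (hmerge hc1 he)
          · exact hc
        exact Or.inl ⟨hz'x, hz'c ▸ hconn⟩
    · -- the step avoids `x`: the same edge in the reduced graph
      have hconnz : Conn ends' ω' m₁ z := by
        rcases hz with ⟨_, hc⟩ | ⟨hzx', _⟩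
        · exact hc
        · exact absurd hzx' hzx
      have hee1 : e ≠ e₁ := by
        rintro rfl
        rw [h1, Sym2.eq_iff] at hends
        rcases hends with ⟨_, hh2⟩ | ⟨_, hh2⟩
        · exact hz'x hh2.symm
        · exact hzx hh2.symm
      have hee2 : e ≠ e₂ := by
        rintro rfl
        rw [h2, Sym2.eq_iff] at hends
        rcases hends with ⟨hh1, _⟩ | ⟨hh1, _⟩
        · exact hzx hh1.symm
        · exact hz'x hh1.symm
      have hadj : OpenAdj ends' ω' z z' :=
        ⟨e, by rw [hω', seriesMap_apply_of_ne hee1]; exact he,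
          by rw [hends', seriesEnds_apply_of_ne hee1 hee2]; exact hends⟩
      exact Or.inl ⟨hz'x, conn_trans hconnz (conn_of_openAdj hadj)⟩
  have hm₁S : m₁ ∈ S := Or.inl ⟨hm₁, conn_refl ends' ω' m₁⟩
  rcases mem_of_conn_of_closed hS hm₁S h with ⟨_, hc⟩ | ⟨hx, _⟩
  · exact hc
  · exact absurd hx hm₂

/-- **Series rule for connections**: for `m₁, m₂ ≠ x`, `m₁ ↔ m₂` in `(ends, ω)` iff in the reduced
graph with the series-mapped configuration. -/
lemma conn_series_iff (h1 : ends e₁ = s(a, x)) (h2 : ends e₂ = s(x, c))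
    (hdeg : ∀ e, x ∈ ends e → e = e₁ ∨ e = e₂) (hax : a ≠ x) (hcx : c ≠ x) (h12 : e₁ ≠ e₂)
    {ω : Config E} {m₁ m₂ : V} (hm₁ : m₁ ≠ x) (hm₂ : m₂ ≠ x) :
    Conn (seriesEnds ends e₁ e₂ a c x) (seriesMap e₁ e₂ ω) m₁ m₂ ↔ Conn ends ω m₁ m₂ :=
  ⟨conn_of_conn_series h1 h2 h12, conn_series_of_conn h1 h2 hdeg hax hcx h12 hm₁ hm₂⟩

end Series


end MM0Series
end Summit.Ventures.PercRepro2
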